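/-
Copyright: the b2b-balaban cell (near-miss cell 7), T⁴-continuum fan-out, lineage t4-ne7b-p3 (node U5c LARGE-DEVIATION
member P3).  Released under the licence of the surrounding project.
-/
import Summits.QuantumFields.BalabanUV.T4Continuum.Support.SpaceTimePeierlsLeaves

/-!
# Space-time Peierls ∕ Cramér route for NE7b — leaf A3b′: VOLUME THROUGH MAINTENANCE (the contour ledger, second form)

Summits-side support leaf of the T⁴-continuum cell (rung (B)+1 on a FINITE torus only; NOT infinite volume, NOT the
mass gap, NOT the Clay statement; NOT a proof of the spine estimate NE7b).  Lineage `t4-ne7b-p3` (generation 1), node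
U5c, skeleton `t4/skeletons/NE7b-t4-ne7b-p3.md` v1.2 leaf A3b′.  [folklore] real arithmetic over the abstract
`SpaceTimePeierlsLeaves.ContourLedger`; nothing is quoted from print and nothing printed is asserted; no `[cite:]` tag.

WHY (skeleton v1.2).  Leaf A3b of v1 bounded the contour volume by the created fatness and the epoch lengths through
the S-operation's halving geometry, with a one-shot constant whose non-compounding across mergers was the first point
the skeleton asked a refuter to attack (§3 (e)).  The route does not need that geometry: the MAINTENANCE functional of
the κ-balance (leaf A3a: a per-scale cost `≥ m₁ · (size + 1)` for every live structure, the cost side of the printed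
exponent) already CHARGES every occupied cell.  So the volume is accounted THROUGH the maintenance:
`|𝒦| ≤ c_d · maint / m₁ + c_d · (total lifetime)` (leaf A3b′, hypothesis shape `VolumeViaMaint`; `c_d` = cubes per unit
of size, `m₁` = the per-size per-scale maintenance rate), and BANKING (`maint ≤ income / 2`, leaf A3d) converts it into
income.  This file proves the resulting per-cell rate (`surplus_ge_rateM_mul_vol`):
`income − maint ≥ s · |𝒦|`, `s = 1 / (c_d/m₁ + 2·c_d·(N′+1)/p̄₀) ≥ ½ · min (m₁/c_d) (p̄₀/(2c_d(N′+1)))` — the survival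
condition of the route becomes «print's maintenance rate per cube AND p̄₀/N′ per cube both beat the animal entropy».

HONEST DEPENDENCY (cell, verbatim): continuum YM on T⁴ ⇐ BetaPertH ∧ nine spine estimates (0/9 proved); BetaPertH ⇐
(D1) ∧ (D4) ∧ CAP+tail; G-an2-4 gates asym, D1 and NE2/3/4.  This file changes none of it.
-/

namespace Summit.QuantumFields.BalabanUV.T4Continuum.SpaceTimePeierlsLeaves

/-- LEAF A3b′ (hypothesis shape, to be PROVED in the index model from the DEFINITION of the maintenance functional and
the tree-length cube count): VOLUME THROUGH MAINTENANCE, `|𝒦| ≤ c_d · maint / m₁ + c_d · (Σ_epochs length + #births)`.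
[folklore] -/
def ContourLedger.VolumeViaMaint (cd m₁ : ℝ) (ℓ : ContourLedger) : Prop :=
  (ℓ.vol : ℝ) ≤ cd * ℓ.maint / m₁ + cd * (ℓ.epochLen + ℓ.births)

/-- the rate of leaf A3b′: `rateM c_d m₁ p̄₀ N′ = 1 / (c_d/m₁ + 2·c_d·(N′+1)/p̄₀)` [folklore] -/
noncomputable def rateM (cd m₁ pbar N' : ℝ) : ℝ := 1 / (cd / m₁ + 2 * cd * (N' + 1) / pbar)

/-- the rate is positive for positive constants [folklore] -/
theorem rateM_pos {cd m₁ pbar N' : ℝ} (hcd : 0 < cd) (hm : 0 < m₁) (hp : 0 < pbar) (hN : 0 ≤ N') :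
    0 < rateM cd m₁ pbar N' := by
  unfold rateM; positivity

/-- **A3b′ ∧ A3c ∧ A3d ∧ R2 ⇒ THE PER-CELL RATE (second form)**: `rateM · |𝒦| ≤ income − maintenance`.
From `maint ≤ income/2`: `vol ≤ c_d·income/(2m₁) + c_d(N′+1)·#epochs ≤ income·(c_d/(2m₁) + c_d(N′+1)/p̄₀)`, and
`income − maint ≥ income/2`. [folklore] -/
theorem ContourLedger.surplus_ge_rateM_mul_vol (ℓ : ContourLedger) {cd m₁ γA pbar N' : ℝ} (hcd : 0 < cd)
    (hm : 0 < m₁) (hγ : 0 ≤ γA) (hp : 0 < pbar) (hN : 0 ≤ N') (hvol : ℓ.VolumeViaMaint cd m₁)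
    (hinc : ℓ.IncomeLower γA pbar) (hbank : ℓ.Banking) (hwin : ℓ.Windows N') :
    rateM cd m₁ pbar N' * ℓ.vol ≤ ℓ.income - ℓ.maint := by
  -- abbreviations and signs
  set E : ℝ := (ℓ.births : ℝ) + ℓ.renewals + ℓ.mergers with hE
  have hE0 : 0 ≤ E := by positivity
  have hfat0 : (0 : ℝ) ≤ ℓ.fat := by positivity
  have hbank' : ℓ.maint ≤ ℓ.income / 2 := hbank
  have hinc' : γA * pbar ^ 2 * ℓ.fat + pbar * E ≤ ℓ.income := by
    have := hinc; unfold ContourLedger.IncomeLower at this; rw [hE]; linarith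
  have hinc0 : 0 ≤ ℓ.income := le_trans (by positivity) hinc'
  -- epochs are paid by income: E ≤ income / p̄₀
  have hEinc : E ≤ ℓ.income / pbar := by
    rw [le_div_iff₀ hp]
    nlinarith [mul_nonneg hγ (mul_nonneg (sq_nonneg pbar) hfat0)]
  -- volume ≤ c_d·maint/m₁ + c_d (N'+1) E ≤ income · (c_d/(2m₁) + c_d (N'+1)/p̄₀)
  have hlife : (ℓ.epochLen : ℝ) + ℓ.births ≤ (N' + 1) * E := by
    have hb : (ℓ.births : ℝ) ≤ E := by
      rw [hE]
      have : (0:ℝ) ≤ ℓ.renewals := by positivity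
      have : (0:ℝ) ≤ ℓ.mergers := by positivity
      linarith
    have := hwin; unfold ContourLedger.Windows at this
    nlinarith
  have hvol' : (ℓ.vol : ℝ) ≤ ℓ.income * (cd / (2 * m₁) + cd * (N' + 1) / pbar) := by
    have h1 : cd * ℓ.maint / m₁ ≤ cd * (ℓ.income / 2) / m₁ :=
      div_le_div_of_nonneg_right (mul_le_mul_of_nonneg_left hbank' hcd.le) hm.le
    have h2 : cd * ((ℓ.epochLen : ℝ) + ℓ.births) ≤ cd * ((N' + 1) * (ℓ.income / pbar)) :=
      mul_le_mul_of_nonneg_left (hlife.trans (mul_le_mul_of_nonneg_left hEinc (by linarith))) hcd.le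
    have := hvol; unfold ContourLedger.VolumeViaMaint at this
    calc (ℓ.vol : ℝ) ≤ cd * ℓ.maint / m₁ + cd * (ℓ.epochLen + ℓ.births) := this
      _ ≤ cd * (ℓ.income / 2) / m₁ + cd * ((N' + 1) * (ℓ.income / pbar)) := add_le_add h1 h2
      _ = ℓ.income * (cd / (2 * m₁) + cd * (N' + 1) / pbar) := by
          field_simp
  -- conclude
  have hD : 0 < cd / m₁ + 2 * cd * (N' + 1) / pbar := by positivity
  have key : ℓ.vol ≤ (ℓ.income / 2) * (cd / m₁ + 2 * cd * (N' + 1) / pbar) := by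
    have : ℓ.income * (cd / (2 * m₁) + cd * (N' + 1) / pbar)
        = (ℓ.income / 2) * (cd / m₁ + 2 * cd * (N' + 1) / pbar) := by
      field_simp
    linarith [hvol', this.le]
  unfold rateM
  rw [one_div, ← div_eq_inv_mul, div_le_iff₀ hD]
  nlinarith [key, hbank']

/-- the second-form rate dominates half the smaller of the two per-cube rates: `½·min(m₁/c_d, p̄₀/(2c_d(N′+1))) ≤ rateM`
(so the route's survival condition may be checked on either). [folklore] -/
theorem half_min_le_rateM {cd m₁ pbar N' : ℝ} (hcd : 0 < cd) (hm : 0 < m₁) (hp : 0 < pbar) (hN : 0 ≤ N') :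
    min (m₁ / cd) (pbar / (2 * cd * (N' + 1))) / 2 ≤ rateM cd m₁ pbar N' := by
  unfold rateM
  set a := cd / m₁ with ha
  set b := 2 * cd * (N' + 1) / pbar with hb
  have ha0 : 0 < a := by positivity
  have hb0 : 0 < b := by positivity
  have h1 : m₁ / cd = 1 / a := by rw [ha]; field_simp
  have h2 : pbar / (2 * cd * (N' + 1)) = 1 / b := by rw [hb]; field_simp
  rw [h1, h2]
  -- min(1/a,1/b)/2 ≤ 1/(a+b): since a + b ≤ 2·max(a,b) and min(1/a,1/b) = 1/max(a,b)
  rcases le_total a b with hab | hab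
  · have hmin : min (1 / a) (1 / b) ≤ 1 / b := min_le_right _ _
    have : 1 / b / 2 ≤ 1 / (a + b) := by
      rw [div_div, div_le_div_iff₀ (by positivity) (by positivity)]
      nlinarith
    linarith [div_le_div_of_nonneg_right hmin (by norm_num : (0:ℝ) ≤ 2)]
  · have hmin : min (1 / a) (1 / b) ≤ 1 / a := min_le_left _ _
    have : 1 / a / 2 ≤ 1 / (a + b) := by
      rw [div_div, div_le_div_iff₀ (by positivity) (by positivity)]
      nlinarith
    linarith [div_le_div_of_nonneg_right hmin (by norm_num : (0:ℝ) ≤ 2)]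

end Summit.QuantumFields.BalabanUV.T4Continuum.SpaceTimePeierlsLeaves
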